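import Literature.Topology.CoveringSpaces.CoveringIdRigidCenter
import Literature.AlgebraicTopology.FundamentalGroup.PuncturedTorusFundamentalGroup
import Literature.AlgebraicTopology.Homotopy.TorusStronglyLocallyContractible
import HarnessLib

/-!
# The categories of (finite) covering spaces of a once-punctured torus are id-rigid

Topic `Literature/Topology/CoveringSpaces` — the type-`(1,1)` instance of the abc-iut cell's campaign-L
R1 capstone «`Cov^fin` of a hyperbolic Riemann surface is id-rigid» (the topological core of [AbsTopIII]
Lem. 4.3 / Prop. 4.2 (i) for the curve type of IUT itself: once-punctured elliptic curves).  For the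
real torus `T = (ℝ/ℤ)^ι` with exactly two indices (`ι → AddCircle 1`; as a space the tree's
`ComplexTorus`, i.e. every complex torus `ℂ/Λ`) and any point `x₀`:

* `Cov.isIdRigid_compl_singleton_torus` — the category `Cov(T ∖ {x₀})` of ALL covering spaces of the
  once-punctured torus is id-rigid (every natural automorphism of the identity functor is trivial);
* `CovFin.isIdRigid_compl_singleton_torus` — the same for the category `Cov^fin(T ∖ {x₀})` of
  finite covering spaces (universe `0`);
* `Cov.isIdRigid_compl_singleton_torus_fin_two`, `CovFin.isIdRigid_compl_singleton_torus_fin_two` —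
  the concrete model `Fin 2 → AddCircle 1`.

One line each from the tree: `π₁(T ∖ {x₀}) ≅ F₂`
(`PuncturedTorus.nonempty_mulEquiv_freeGroup_puncturedTorus`, Hatcher Ch. 0 Ex. 1 + §1.2 Thm. 1.20),
`T ∖ {x₀}` path connected (`PuncturedTorus.pathConnectedSpace_compl_singleton_torus`) and strongly
locally contractible (`stronglyLocallyContractibleSpace_compl_singleton_pi_addCircle`), and
`Cov(X)`/`Cov^fin(X)` id-rigid whenever `π₁(X) ≅ F_n`, `n ≥ 2`
(`Cov.isIdRigid_of_mulEquiv_freeGroup` / `CovFin.isIdRigid_of_mulEquiv_freeGroup`: the centre of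
`F_n`, resp. of its profinite completion, is trivial).  Proof-only; no definitions.

## References
* S. Mochizuki, *Topics in Absolute Anabelian Geometry III*, J. Math. Sci. Univ. Tokyo 22 (2015),
  Lem. 4.3, Prop. 4.2 (i) p. 106. [MochizukiAbsTopIII2015]
* A. Hatcher, *Algebraic Topology*, CUP (2002), Ch. 0 Ex. 1 (p. 18), §1.2 Thm. 1.20. [HatcherAT2002]
-/

noncomputable section

open CategoryTheory Set
open Literature.AnabelianGeometry.AbsoluteAnabelian (IsIdRigid)
open Literature.AlgebraicTopology.FundamentalGroup

universe u

namespace Literature.Topology.CoveringSpaces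

/-- **`Cov` of a once-punctured torus is id-rigid**: for `T = (ℝ/ℤ)^ι` with exactly two indices
`i₀ ≠ i₁` and any `x₀ ∈ T`, every natural automorphism of the identity functor of the category of
covering spaces of `T ∖ {x₀}` is the identity (`π₁ ≅ F₂` has trivial centre).
[cite: MochizukiAbsTopIII2015, Proposition 4.2 (i) p.106] -/
theorem Cov.isIdRigid_compl_singleton_torus {ι : Type u} [Fintype ι] [DecidableEq ι] {i₀ i₁ : ι}
    (hne : i₀ ≠ i₁) (hι : ∀ i, i = i₀ ∨ i = i₁) (x₀ : ι → AddCircle (1 : ℝ)) :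
    IsIdRigid (Cov ({x₀}ᶜ : Set (ι → AddCircle (1 : ℝ)))) := by
  haveI := PuncturedTorus.pathConnectedSpace_compl_singleton_torus hι x₀
  haveI := Literature.AlgebraicTopology.Homotopy.stronglyLocallyContractibleSpace_compl_singleton_pi_addCircle
    (ι := ι) (one_ne_zero (α := ℝ)) x₀
  have y : ({x₀}ᶜ : Set (ι → AddCircle (1 : ℝ))) := Classical.arbitrary _
  obtain ⟨e⟩ := PuncturedTorus.nonempty_mulEquiv_freeGroup_puncturedTorus hne hι x₀ y
  exact Cov.isIdRigid_of_mulEquiv_freeGroup y e le_rfl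

/-- **`Cov^fin` of a once-punctured torus is id-rigid** (universe `0`): the category of FINITE
covering spaces of `T ∖ {x₀}`, `T = (ℝ/ℤ)^ι` with exactly two indices, is id-rigid (`π̂₁ = F̂₂` is
slim). The type-`(1,1)` case of the topological core of [AbsTopIII] Prop. 4.2 (i), unconditionally.
[cite: MochizukiAbsTopIII2015, Proposition 4.2 (i) p.106] -/
theorem CovFin.isIdRigid_compl_singleton_torus {ι : Type} [Fintype ι] [DecidableEq ι] {i₀ i₁ : ι}
    (hne : i₀ ≠ i₁) (hι : ∀ i, i = i₀ ∨ i = i₁) (x₀ : ι → AddCircle (1 : ℝ)) :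
    IsIdRigid (CovFin ({x₀}ᶜ : Set (ι → AddCircle (1 : ℝ)))) := by
  haveI := PuncturedTorus.pathConnectedSpace_compl_singleton_torus hι x₀
  haveI := Literature.AlgebraicTopology.Homotopy.stronglyLocallyContractibleSpace_compl_singleton_pi_addCircle
    (ι := ι) (one_ne_zero (α := ℝ)) x₀
  have y : ({x₀}ᶜ : Set (ι → AddCircle (1 : ℝ))) := Classical.arbitrary _
  obtain ⟨e⟩ := PuncturedTorus.nonempty_mulEquiv_freeGroup_puncturedTorus hne hι x₀ y
  exact CovFin.isIdRigid_of_mulEquiv_freeGroup y e le_rfl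

/-- `Cov` of the once-punctured torus `(Fin 2 → ℝ/ℤ) ∖ {x₀}` is id-rigid.
[cite: MochizukiAbsTopIII2015, Proposition 4.2 (i) p.106] -/
theorem Cov.isIdRigid_compl_singleton_torus_fin_two (x₀ : Fin 2 → AddCircle (1 : ℝ)) :
    IsIdRigid (Cov ({x₀}ᶜ : Set (Fin 2 → AddCircle (1 : ℝ)))) :=
  Cov.isIdRigid_compl_singleton_torus (i₀ := (0 : Fin 2)) (i₁ := 1) (by decide)
    (fun i ↦ by fin_cases i <;> simp) x₀

/-- `Cov^fin` of the once-punctured torus `(Fin 2 → ℝ/ℤ) ∖ {x₀}` is id-rigid.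
[cite: MochizukiAbsTopIII2015, Proposition 4.2 (i) p.106] -/
theorem CovFin.isIdRigid_compl_singleton_torus_fin_two (x₀ : Fin 2 → AddCircle (1 : ℝ)) :
    IsIdRigid (CovFin ({x₀}ᶜ : Set (Fin 2 → AddCircle (1 : ℝ)))) :=
  CovFin.isIdRigid_compl_singleton_torus (i₀ := (0 : Fin 2)) (i₁ := 1) (by decide)
    (fun i ↦ by fin_cases i <;> simp) x₀

end Literature.Topology.CoveringSpaces

end
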